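import Mathlib
import HarnessLib
import Literature.Analysis.FluidPDE.AxisymmetricEuler
import Literature.Analysis.FluidPDE.VectorCalculus
import Literature.Analysis.FluidPDE.SelfSimilarLiouvilleSwirlDecayProofs
import Literature.Analysis.FluidPDE.AxisymSwirlDriftHeatData
import Literature.Analysis.FluidPDE.DriftHeatLocalComparison
import Summits.NavierStokesRegularity.NavierStokesRegularity.Theorems.ScenarioCensusAncient
import Summits.NavierStokesRegularity.NavierStokesRegularity.Theorems.ScenarioCensusSubRows
import Summits.NavierStokesRegularity.NavierStokesRegularity.Theses.SwirlThreshold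
import Literature.Analysis.FluidPDE.SelfSimilarLiouvilleSwirlSupProofs

/-!
# Census rows A5fe / A5fi (ns-idea-4 LINE «one-cycle» = the Feller–swirl dictionary) — part 1/7: §S1 the comparison tool on compact boxes (general finite-dimensional Borel `E`; `boxComparison_general`)

Re-homed for the scenario census from ns-idea-4 g19's LINE g19-1 «one-cycle» v2.3 (`pub/ideators/ns-idea-4/lines/one-cycle/OneCycle_v2_3.lean`,
sha16 f100b791173babd1, 2236 l.; idea-crit-3 g10 RE-STAMP 2026-08-29T11:36:32Z CONFORMS — PASS CARRIES, 0 sorry, std axioms; ns-census-ref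
g13/g14 PRE-CHECK BY NAME ✓; director-ns KEY-NS #215), split into seven files for the 400-line rule:
`ScenarioCensusRowA5FsBox` → `…FsStatements` → `…FsSlice` → `…FsCycle` → `…FsEngine` → `…FsRuns` → `ScenarioCensusRowA5FellerSwirl`.
Lean text verbatim in namespace `…Theorems.ScenarioCensus.FellerSwirl` (the line's `…Cruxes.ScenarioCensusRowA5.OneCycleLine` re-homed;
port edits: the general box comparison moved out of the `Literature…IsDriftHeatSolutionOn` namespace as `boxComparison_general`,
the census-row Props used BY NAME from the tree (`Row_A5fe` / `Row_A5fi`, no restatement), stub docstrings added where missing).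

WHAT THE SEVEN FILES PROVE (0 `sorry`): census rows A5fe and A5fi (`ScenarioCensusSubRows.lean` :151 / :139) — a bounded ancient mild
axisymmetric solution (ν = 1, measurable slices) with bounded swirl `Γ = r u_θ` and inflow number `−r u_r ≤ 2 − δ` a.e. on `{r ≥ R₀}`
(A5fe; everywhere for A5fi) has a.e.-constant slices — and the δ = 0 sharpening `CriticalEventualFellerSwirlLiouville`. Row A5 itself
follows only from the row-strength OPEN hypothesis K1 `FarFieldInflowBound` (`row_A5_of_farFieldInflowBound`); Row_A5, every NS crux and
NS regularity remain OPEN — nothing about them is asserted; no census value is asserted here (the census lead books rows).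
-/

noncomputable section
set_option linter.dupNamespace false

open MeasureTheory Set Function Filter Topology InnerProductSpace
open scoped Laplacian RealInnerProductSpace ContDiff ENNReal

namespace Summit.NavierStokesRegularity.NavierStokesRegularity.Theorems.ScenarioCensus.FellerSwirl

open Literature.Analysis.FluidPDE
open Summit.NavierStokesRegularity.NavierStokesRegularity.Theorems.ScenarioCensus (Row_A5 Row_A5fe Row_A5fi row_A5fi_of_row_A5fe)

/-! ## §S1 (g19, PROVED) Comparison on a compact box for the local time-integrated drift–heat class
(`boxComparison_general`; general finite-dimensional Borel `E`;
Lieberman 1996 Ch. II Cor. 2.5 in the time-integrated class: the proof of the tree's `paraboloid_comparison` run on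
`[t_b,t_T] × D` with the continuous majorant `J = Δ(g−φ) + A‖∇(g−φ)‖ − θ` at an interior maximum). -/

section BoxComparisonGeneral

open TopologicalSpace Metric


variable {E : Type*} [NormedAddCommGroup E] [InnerProductSpace ℝ E] [FiniteDimensional ℝ E]
  [MeasurableSpace E]


variable {a : ℝ → E → E} {g : ℝ → E → ℝ} {A : ℝ} {S : Set ℝ} {U : Set E}

/-- **Comparison principle on a compact cylinder, local time-integrated class, pointwise super-solution.**
Lieberman 1996 Ch. II Cor. 2.5: the proof of `paraboloid_comparison` with the region `[t_b,t_T] × D`, `D ⊆ U`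
compact, and the continuous majorant `J = Δ(g−φ) + A‖∇(g−φ)‖ − θ`. -/
theorem boxComparison_general [BorelSpace E] (hg : IsDriftHeatSolutionOn a g A S U) (hU : IsOpen U)
    {D : Set E} {t_b t_T : ℝ} (hS : Icc t_b t_T ⊆ S) (hD : IsCompact D) (hDU : D ⊆ U)
    {φ φt : ℝ → E → ℝ}
    (hφ_c : ContinuousOn (uncurry φ) (Icc t_b t_T ×ˢ U))
    (hφ2 : ∀ t ∈ Icc t_b t_T, ContDiffOn ℝ 2 (φ t) U)
    (hφt : ∀ x ∈ U, ∀ t ∈ Icc t_b t_T, HasDerivAt (fun τ => φ τ x) (φt t x) t)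
    (hφt_c : ∀ x ∈ U, ContinuousOn (fun τ => φt τ x) (Icc t_b t_T))
    (hφD_c : ∀ x ∈ U, ContinuousOn (fun τ => fderiv ℝ (φ τ) x) (Icc t_b t_T))
    (hφΔ_c : ∀ x ∈ U, ContinuousOn (fun τ => (Δ (φ τ)) x) (Icc t_b t_T))
    (hφ_ineq : ∀ t ∈ Ioc t_b t_T, ∀ x ∈ interior D,
      (Δ (φ t)) x - fderiv ℝ (φ t) x (a t x) ≤ φt t x)
    (hbot : ∀ x ∈ D, g t_b x ≤ φ t_b x)
    (hside : ∀ t ∈ Icc t_b t_T, ∀ x ∈ D \ interior D, g t x ≤ φ t x) :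
    ∀ t ∈ Icc t_b t_T, ∀ x ∈ D, g t x ≤ φ t x := by
  set K : Set (ℝ × E) := Icc t_b t_T ×ˢ D with hK
  have hKc : IsCompact K := isCompact_Icc.prod hD
  have hKU : K ⊆ Icc t_b t_T ×ˢ U := prod_mono Subset.rfl hDU
  have hg_c : ContinuousOn (uncurry g) (Icc t_b t_T ×ˢ U) := hg.continuousOn_uncurry hU hS
  have main : ∀ θ : ℝ, 0 < θ → ∀ p ∈ K, g p.1 p.2 - φ p.1 p.2 - θ * (p.1 - t_b) ≤ 0 := by
    intro θ hθ
    set w : ℝ × E → ℝ := fun p => g p.1 p.2 - φ p.1 p.2 - θ * (p.1 - t_b) with hw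
    have hwc : ContinuousOn w K := by
      refine (((hg_c.mono hKU).sub (hφ_c.mono hKU)).sub ?_)
      exact (continuous_const.mul (continuous_fst.sub continuous_const)).continuousOn
    by_contra hcon
    push Not at hcon
    obtain ⟨p₁, hp₁K, hp₁⟩ := hcon
    obtain ⟨X, hXK, hXmax⟩ := hKc.exists_isMaxOn ⟨p₁, hp₁K⟩ hwc
    have hXpos : 0 < w X := hp₁.trans_le (hXmax hp₁K)
    obtain ⟨ts, xs⟩ := X
    have htsI : ts ∈ Icc t_b t_T := (mem_prod.1 hXK).1
    have hxsD : xs ∈ D := (mem_prod.1 hXK).2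
    have hxsU : xs ∈ U := hDU hxsD
    -- not on the bottom
    have hts_ne : ts ≠ t_b := by
      intro h
      subst h
      have := hbot xs hxsD
      simp [hw] at hXpos
      linarith
    have hts_gt : t_b < ts := lt_of_le_of_ne htsI.1 (Ne.symm hts_ne)
    have htsIoc : ts ∈ Ioc t_b t_T := ⟨hts_gt, htsI.2⟩
    have htsS : ts ∈ S := hS htsI
    -- in the interior of `D`
    have hxs_int : xs ∈ interior D := by
      by_contra h
      have h1 := hside ts htsI xs ⟨hxsD, h⟩
      have h2 : 0 ≤ θ * (ts - t_b) := mul_nonneg hθ.le (by linarith)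
      simp [hw] at hXpos
      linarith
    -- spatial local maximum at `xs`
    set W : E → ℝ := fun x => g ts x - φ ts x - θ * (ts - t_b) with hW
    have hW2 : ContDiffOn ℝ 2 W U :=
      ((hg.contDiffOn ts htsS).sub (hφ2 ts htsI)).sub contDiffOn_const
    have hWmax : IsLocalMax W xs := by
      filter_upwards [isOpen_interior.mem_nhds hxs_int] with x hx
      exact hXmax (show (ts, x) ∈ K from mem_prod.2 ⟨htsI, interior_subset hx⟩)
    have hDW : fderiv ℝ W xs = 0 := IsLocalMax.fderiv_eq_zero hWmax
    have hΔW : (Δ W) xs ≤ 0 := laplacian_nonpos_of_isLocalMax_of_contDiffOn hU hxsU hW2 hWmax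
    have hgc : ContDiffAt ℝ 2 (g ts) xs := (hg.contDiffOn ts htsS).contDiffAt (hU.mem_nhds hxsU)
    have hφc : ContDiffAt ℝ 2 (φ ts) xs := (hφ2 ts htsI).contDiffAt (hU.mem_nhds hxsU)
    have hgd : DifferentiableAt ℝ (g ts) xs := hgc.differentiableAt (by norm_num)
    have hvd : DifferentiableAt ℝ (φ ts) xs := hφc.differentiableAt (by norm_num)
    have hDeq : fderiv ℝ (g ts) xs = fderiv ℝ (φ ts) xs := by
      have h1 : fderiv ℝ W xs = fderiv ℝ (g ts) xs - fderiv ℝ (φ ts) xs := by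
        rw [hW, fderiv_sub_const, fderiv_fun_sub hgd hvd]
      rw [h1] at hDW
      exact sub_eq_zero.1 hDW
    have hΔeq : (Δ W) xs = (Δ (g ts)) xs - (Δ (φ ts)) xs := by
      have h1 : W = (g ts - φ ts) - fun _ => θ * (ts - t_b) := by funext x; simp [hW]
      have hc1 : ContDiffAt ℝ 2 (g ts - φ ts) xs := hgc.sub hφc
      rw [h1, hc1.laplacian_sub contDiffAt_const, hgc.laplacian_sub hφc, laplacian_const]
      simp
    have hA : 0 ≤ A := hg.drift_bound_nonneg htsS hxsU
    -- continuity of `∇g(·, xs)`, `Δg(·, xs)` on `(t_b, t_T]`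
    have hIocS : Ioc t_b t_T ⊆ S := Ioc_subset_Icc_self.trans hS
    have hgD_c : ContinuousOn (fun τ => fderiv ℝ (g τ) xs) (Ioc t_b t_T) :=
      continuousOn_time_slice (F := fun p : ℝ × E => fderiv ℝ (g p.1) p.2)
        hg.continuousOn_fderiv hxsU hIocS
    have hgΔ_c : ContinuousOn (fun τ => (Δ (g τ)) xs) (Ioc t_b t_T) :=
      continuousOn_time_slice (F := fun p : ℝ × E => (Δ (g p.1)) p.2)
        hg.continuousOn_laplacian hxsU hIocS
    -- the continuous majorant `J` of the integrand, `≤ -θ` at `ts`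
    set J : ℝ → ℝ := fun τ => (Δ (g τ)) xs - (Δ (φ τ)) xs +
      A * ‖fderiv ℝ (g τ) xs - fderiv ℝ (φ τ) xs‖ - θ with hJ
    have hJc : ContinuousOn J (Ioc t_b t_T) := by
      refine ((hgΔ_c.sub ((hφΔ_c xs hxsU).mono Ioc_subset_Icc_self)).add
        (continuousOn_const.mul
          (hgD_c.sub ((hφD_c xs hxsU).mono Ioc_subset_Icc_self)).norm)).sub continuousOn_const
    have hJts : J ts ≤ -θ := by
      have h0 : ‖fderiv ℝ (g ts) xs - fderiv ℝ (φ ts) xs‖ = 0 := by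
        rw [hDeq, sub_self, norm_zero]
      simp only [hJ, h0, mul_zero, add_zero]
      linarith [hΔW, hΔeq]
    -- (a) `J < -θ/2` near `ts` within `(t_b, t_T]`
    obtain ⟨δ₁, hδ₁, hJneg⟩ : ∃ δ₁ > 0, ∀ τ ∈ Ioc t_b t_T, dist τ ts < δ₁ → J τ < -θ / 2 := by
      have hev : ∀ᶠ τ in 𝓝[Ioc t_b t_T] ts, J τ < -θ / 2 :=
        (hJc ts htsIoc).eventually (gt_mem_nhds (by linarith))
      rw [eventually_nhdsWithin_iff, Metric.eventually_nhds_iff] at hev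
      obtain ⟨δ₁, hδ₁, h⟩ := hev
      exact ⟨δ₁, hδ₁, fun τ hτ hd => h hd hτ⟩
    -- the earlier time `t₁`
    set δ : ℝ := min δ₁ (ts - t_b) / 2 with hδ
    have hδpos : 0 < δ := by
      have : 0 < min δ₁ (ts - t_b) := lt_min hδ₁ (by linarith)
      rw [hδ]; linarith
    have hδ1 : δ < δ₁ := by
      have : min δ₁ (ts - t_b) ≤ δ₁ := min_le_left _ _
      rw [hδ]; linarith
    have hδ3 : δ < ts - t_b := by
      have : min δ₁ (ts - t_b) ≤ ts - t_b := min_le_right _ _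
      rw [hδ]; linarith
    set t₁ : ℝ := ts - δ with ht₁
    have ht₁_gt : t_b < t₁ := by rw [ht₁]; linarith
    have ht₁_lt : t₁ < ts := by rw [ht₁]; linarith
    have hnear : ∀ τ ∈ Icc t₁ ts, dist τ ts < δ₁ ∧ τ ∈ Ioc t_b t_T := by
      intro τ hτ
      have hd : dist τ ts ≤ δ := by
        rw [Real.dist_eq, abs_sub_comm, abs_of_nonneg (by linarith [hτ.2])]
        linarith [hτ.1]
      exact ⟨hd.trans_lt hδ1, ⟨by linarith [hτ.1], hτ.2.trans htsI.2⟩⟩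
    have ht₁I : t₁ ∈ Icc t_b t_T := ⟨ht₁_gt.le, ht₁_lt.le.trans htsI.2⟩
    have ht₁K : (t₁, xs) ∈ K := mem_prod.2 ⟨ht₁I, hxsD⟩
    have hwle : w (t₁, xs) ≤ w (ts, xs) := hXmax ht₁K
    -- the integral identity for `w (ts, xs) - w (t₁, xs)`
    set I : ℝ → ℝ := fun τ =>
      ((Δ (g τ)) xs - fderiv ℝ (g τ) xs (a τ xs)) - φt τ xs - θ with hI
    have hsubI : uIcc t₁ ts ⊆ Icc t_b t_T := by
      rw [uIcc_of_le ht₁_lt.le]; exact Icc_subset_Icc ht₁_gt.le htsI.2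
    have hi1 : IntervalIntegrable (fun τ => φt τ xs) volume t₁ ts :=
      (((hφt_c xs hxsU)).mono hsubI).intervalIntegrable
    have hvFTC : φ ts xs - φ t₁ xs = ∫ τ in t₁..ts, φt τ xs :=
      (intervalIntegral.integral_eq_sub_of_hasDerivAt
        (fun τ hτ => hφt xs hxsU τ (hsubI hτ)) hi1).symm
    have hIccS : Icc t₁ ts ⊆ S := (Icc_subset_Icc ht₁_gt.le htsI.2).trans hS
    have hgFTC := hg.integral_eq xs hxsU t₁ (hS ht₁I) ts htsS ht₁_lt.le
    have hi2 : IntervalIntegrable (fun τ => (Δ (g τ)) xs - fderiv ℝ (g τ) xs (a τ xs))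
        volume t₁ ts := hg.intervalIntegrable hxsU ht₁_lt.le hIccS
    have hi3 : IntervalIntegrable (fun _ : ℝ => θ) volume t₁ ts := intervalIntegrable_const
    have hdiff : w (ts, xs) - w (t₁, xs) = ∫ τ in t₁..ts, I τ := by
      have h1 : ∫ τ in t₁..ts, I τ =
          (∫ τ in t₁..ts, ((Δ (g τ)) xs - fderiv ℝ (g τ) xs (a τ xs))) -
            (∫ τ in t₁..ts, φt τ xs) - ∫ τ in t₁..ts, θ := by
        rw [hI, intervalIntegral.integral_sub (hi2.sub hi1) hi3,
          intervalIntegral.integral_sub hi2 hi1]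
      rw [h1, ← hvFTC, ← hgFTC, intervalIntegral.integral_const, smul_eq_mul]
      simp only [hw]
      ring
    -- pointwise: `I ≤ J < -θ/2` on `[t₁, ts]`
    have hIle : ∀ τ ∈ Icc t₁ ts, I τ ≤ -θ / 2 := by
      intro τ hτ
      obtain ⟨hd1, hτI⟩ := hnear τ hτ
      have h1 : (Δ (φ τ)) xs - fderiv ℝ (φ τ) xs (a τ xs) ≤ φt τ xs :=
        hφ_ineq τ hτI xs hxs_int
      have h2 : -((fderiv ℝ (g τ) xs - fderiv ℝ (φ τ) xs) (a τ xs)) ≤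
          A * ‖fderiv ℝ (g τ) xs - fderiv ℝ (φ τ) xs‖ := by
        calc -((fderiv ℝ (g τ) xs - fderiv ℝ (φ τ) xs) (a τ xs))
            ≤ ‖(fderiv ℝ (g τ) xs - fderiv ℝ (φ τ) xs) (a τ xs)‖ := by
              have := Real.le_norm_self (-((fderiv ℝ (g τ) xs - fderiv ℝ (φ τ) xs) (a τ xs)))
              rwa [norm_neg] at this
          _ ≤ ‖fderiv ℝ (g τ) xs - fderiv ℝ (φ τ) xs‖ * ‖a τ xs‖ := ContinuousLinearMap.le_opNorm _ _
          _ ≤ ‖fderiv ℝ (g τ) xs - fderiv ℝ (φ τ) xs‖ * A :=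
              mul_le_mul_of_nonneg_left
                (hg.norm_drift_le τ (hS (Ioc_subset_Icc_self hτI)) xs hxsU) (norm_nonneg _)
          _ = A * ‖fderiv ℝ (g τ) xs - fderiv ℝ (φ τ) xs‖ := mul_comm _ _
      have h3 : (fderiv ℝ (g τ) xs - fderiv ℝ (φ τ) xs) (a τ xs) =
          fderiv ℝ (g τ) xs (a τ xs) - fderiv ℝ (φ τ) xs (a τ xs) :=
        sub_apply _ _ _
      have h4 : I τ ≤ J τ := by
        simp only [hI, hJ]
        rw [h3] at h2
        linarith
      exact h4.trans (hJneg τ hτI hd1).le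
    have hIint : IntervalIntegrable I volume t₁ ts := (hi2.sub hi1).sub hi3
    have hint_le : ∫ τ in t₁..ts, I τ ≤ ∫ _ in t₁..ts, (-θ / 2 : ℝ) :=
      intervalIntegral.integral_mono_on ht₁_lt.le hIint intervalIntegrable_const hIle
    have hneg : ∫ τ in t₁..ts, I τ < 0 := by
      refine hint_le.trans_lt ?_
      rw [intervalIntegral.integral_const, smul_eq_mul]
      nlinarith
    linarith [hdiff, hneg, hwle]
  -- `θ → 0`
  intro t ht x hx
  by_contra hcon
  push Not at hcon
  set d : ℝ := g t x - φ t x with hd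
  have hdpos : 0 < d := by rw [hd]; linarith
  have htT : t_b ≤ t_T := ht.1.trans ht.2
  have h := main (d / (2 * (t_T - t_b) + 2)) (by positivity) (t, x) (mem_prod.2 ⟨ht, hx⟩)
  simp only at h
  have h1 : d / (2 * (t_T - t_b) + 2) * (t - t_b) ≤ d / (2 * (t_T - t_b) + 2) * (t_T - t_b) :=
    mul_le_mul_of_nonneg_left (by linarith [ht.2]) (by positivity)
  have h2 : d / (2 * (t_T - t_b) + 2) * (t_T - t_b) < d := by
    rw [div_mul_eq_mul_div, div_lt_iff₀ (by linarith)]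
    nlinarith
  linarith



end BoxComparisonGeneral

end Summit.NavierStokesRegularity.NavierStokesRegularity.Theorems.ScenarioCensus.FellerSwirl

end
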